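import Summits.HubbardSuperconductivity.HubbardSuperconductivity.Theorems.FunctionFieldCertificateAssemblyFejerGlue
import Summits.HubbardSuperconductivity.HubbardSuperconductivity.Theorems.FunctionFieldCertificateMesoscopicPairOrderNecessity
import HarnessLib

/-!
# Crux `MesoscopicPairOrder` (stmt-HubbardSuperconductivity-7331) — ONE-SCALE COLLAPSE given the pole half

Supports item `stmt-HubbardSuperconductivity-7331` (route `FunctionFieldCertificate`, pole-free crux:
at one `(U, δ)` a margin `m R²` for the Fejér-box average
`T_R(ψ)/L² = L⁻² Σ_{x,y} Πᵢ (1 - |(y - x)ᵢ|_L/R)₊ Re⟨P_x ψ, P_y ψ⟩` of the `d`-wave pair correlation at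
ARBITRARILY LARGE scales `R`, in every normalised `(N_L, S^z = 0)`-sector ground state of all large
even tori). The crux is open physics and is not settled here. What this file proves is the typed
content of the crux-idea cards `one-scale-seed-fejer-ladder` (§S6, `SeedAndWindowGiveCrux`) and
`k0-domination-single-scale` (`SingleScaleExcess`), which nobody had kernel-checked:

**given the pole half at the same `(U, δ)`, the `∀ R₀ ∃ R ≥ R₀` of the crux collapses to ONE scale.**

* (inline) the route's literal window sum (closed window `|q_m|² ≤ ε²`, `if`-form,
  `D m = pairFieldAt dWaveFormFactor L m` by `rfl`) dominates the strict-window sum of the tree's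
  Fejér closure, termwise (`pairStructureFactor ≥ 0`; the same five lines as the Assembly's private
  `strictWindow_le_window` / `WindowInfraredBound.leak_strictWindow_le_window`);
* `dWave_localPairNormBound_sq_le` — the crude local-pair constant of the `d`-wave form factor,
  `C_d = Σ_{e ∈ {0,±e₁,±e₂}} 2|g_d(e)|/√2 ≤ 4√2`, so `C_d² ≤ 32`;
* `pairOrder_ge_seed_sub_window_sub_tail` — POINTWISE ONE-SCALE CLOSURE (one even side `L`, one
  vector): if a unit vector `ψ` has Fejér-box order `m₀ R₀² ≤ T_{R₀}(ψ)/L²` at ONE scale `0 < R₀`,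
  `2R₀ ≤ L`, and window pair weight `Σ_{m ≠ 0, |q_m| ≤ ε} S_ψ(m) ≤ C ε L²`, then
  `m₀ - C ε - 64π²/(R₀² ε²) ≤ Re⟨ψ, Δ_dᴴ Δ_d ψ⟩/L⁴` (the tree's `fejer_glue` read at `η = ε`, plus the
  two items above);
* `uniformPairOrder_of_seed_of_window` — at a fixed `(U, δ)`: a SEED (the crux body at one scale `R₀`
  with margin `m₀`, all large even `L`, every normalised sector ground state) and the Σ-form window
  bound of `WindowInfraredBound` AT THAT `(U, δ)` with constants `(C, ε₀)` give uniform sector pair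
  order `a ≤ Re⟨ψ, Δ_dᴴΔ_d ψ⟩/L⁴` with `a = m₀ - C ε - 64π²/(R₀² ε²)` for any `ε ∈ (0, ε₀]`;
* `mesoscopicPairOrder_of_seed_of_window` — hence, as soon as `C ε + 64π²/(R₀² ε²) < m₀` for some
  `ε ≤ ε₀`, the crux `MesoscopicPairOrder` holds (same `(U, δ)`, margin `a`, at EVERY scale, by
  `mesoscopicPairOrder_of_uniformPairOrder`);
* `mesoscopicPairOrder_of_seed_of_windowInfraredBound` — the same with the route's pole half
  `WindowInfraredBound` (stmt-1089) supplying the window constants;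
* `mesoscopicPairOrderOfSeedOfWindow` — registered form.

Reading for the planner. With the pole half in hand, item 7331 may be re-cut to a SINGLE-SCALE seed
`SeedPairOrder(U, δ, m₀, R₀)` — one finite-range statement, certifiable by one finite-degree
certificate — at the price of the pole half's constants: the seed scale must satisfy
`R₀ > 8π/(ε √m₀)` roughly (`64π²/(R₀²ε²) < m₀`), with `ε ≤ ε₀` small enough that `C ε < m₀`. Without the
pole half no single scale suffices (the scale ladder `T_{kR}/(kR)² ≤ T_R/R²` only DEcreases, tree
`fejerBox_mul_antitone`). Conversely the crux gives the seed at every scale (`mesoscopicPairOrder_iff_forall_scale`).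

Sources: Kennedy–Lieb–Shastry, PRL 61 (1988) 2582 (Parseval bookkeeping of an order operator);
Dyson–Lieb–Simon, J. Stat. Phys. 18 (1978) 335, Thms 3.1–4.2 (infrared bound ⇒ LRO by excluding a
window); Stein–Shakarchi, *Fourier Analysis*, Ch. 2 (Fejér kernel). Folklore; no definition is
introduced; the Hubbard Hamiltonian enters only through the hypotheses.
-/

noncomputable section

-- the summit namespace `Summit.HubbardSuperconductivity.HubbardSuperconductivity.…` repeats the problem name by design (D-0017)
set_option linter.dupNamespace false

namespace Summit.HubbardSuperconductivity.HubbardSuperconductivity.Theorems.FunctionFieldCertificate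

open Matrix Finset Filter
open Literature.Probability.LatticeModels Literature.MathematicalPhysics.QuantumLattice
open Summit.HubbardSuperconductivity.HubbardSuperconductivity.Theses.FunctionFieldCertificate
open scoped ComplexOrder

/-! ### The local-pair constant of the `d`-wave form factor -/

/-- The crude local-pair constant of the `d`-wave form factor is at most `4√2`:
`C_d = Σ_{e ∈ {0, ±e₁, ±e₂}} 2|g_d(e)|/√2 ≤ 4√2` (`|g_d| ≤ 1`, `g_d(0) = 0`, four unit steps), hence
`C_d² ≤ 32`. [folklore] -/
theorem dWave_localPairNormBound_sq_le :
    (∑ e ∈ insert (0 : Site 2) unitSteps, ‖((dWaveFormFactor e / Real.sqrt 2 : ℝ) : ℂ)‖ * 2) ^ 2 ≤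
      32 := by
  have h2 : (0 : ℝ) < Real.sqrt 2 := Real.sqrt_pos.2 two_pos
  have habs : ∀ e : Site 2, |dWaveFormFactor e| ≤ 1 := fun e => by
    unfold dWaveFormFactor
    split_ifs <;> simp
  have hcard : (unitSteps).card ≤ 4 := by
    unfold unitSteps
    refine (Finset.card_insert_le _ _).trans ?_
    refine Nat.succ_le_succ ((Finset.card_insert_le _ _).trans ?_)
    refine Nat.succ_le_succ ((Finset.card_insert_le _ _).trans ?_)
    simp
  have hnn : 0 ≤ ∑ e ∈ insert (0 : Site 2) unitSteps,
      ‖((dWaveFormFactor e / Real.sqrt 2 : ℝ) : ℂ)‖ * 2 :=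
    Finset.sum_nonneg fun e _ => by positivity
  have hle : (∑ e ∈ insert (0 : Site 2) unitSteps, ‖((dWaveFormFactor e / Real.sqrt 2 : ℝ) : ℂ)‖ * 2) ≤
      4 * Real.sqrt 2 := by
    rw [Finset.sum_insert_zero (by simp)]
    calc ∑ e ∈ unitSteps, ‖((dWaveFormFactor e / Real.sqrt 2 : ℝ) : ℂ)‖ * 2
        ≤ ∑ _e ∈ unitSteps, Real.sqrt 2 := Finset.sum_le_sum fun e _ => by
            rw [Complex.norm_real, Real.norm_eq_abs, abs_div, abs_of_pos h2, div_mul_eq_mul_div,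
              div_le_iff₀ h2, Real.mul_self_sqrt zero_le_two]
            linarith [habs e]
      _ = (unitSteps.card : ℝ) * Real.sqrt 2 := by rw [Finset.sum_const, nsmul_eq_mul]
      _ ≤ 4 * Real.sqrt 2 := by
            gcongr
            exact_mod_cast hcard
  calc (∑ e ∈ insert (0 : Site 2) unitSteps, ‖((dWaveFormFactor e / Real.sqrt 2 : ℝ) : ℂ)‖ * 2) ^ 2
      ≤ (4 * Real.sqrt 2) ^ 2 := pow_le_pow_left₀ hnn hle 2
    _ = 32 := by rw [mul_pow, Real.sq_sqrt zero_le_two]; norm_num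

/-! ### Pointwise one-scale closure -/

section Pointwise

variable {L : ℕ} [NeZero L]

/-- **Pointwise one-scale closure.** For a unit vector `ψ` on the torus of side `L`, a scale
`0 < R₀` with `2R₀ ≤ L` and a window `ε > 0`: if the Fejér-box `d`-wave order at the ONE scale `R₀`
is `m₀ R₀² ≤ T_{R₀}(ψ)/L²` and the route's window pair weight is `Σ_{m ≠ 0, |q_m| ≤ ε} S_ψ(m) ≤ C ε L²`,
then the zero-momentum pair order obeys `m₀ - C ε - 64π²/(R₀² ε²) ≤ Re⟨ψ, Δ_dᴴ Δ_d ψ⟩/L⁴`.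
(The tree's `fejer_glue` at `η = ε`: block term `≥ m₀`, window term `≤ C ε`, tail term
`2π² C_d²/(R₀² ε²) ≤ 64π²/(R₀² ε²)`.) Kennedy–Lieb–Shastry (1988); Dyson–Lieb–Simon (1978) Thm 3.1.
[folklore] -/
theorem pairOrder_ge_seed_sub_window_sub_tail (R₀ : ℕ) (hR₀ : 0 < R₀) (hRL : 2 * R₀ ≤ L)
    (ε C m₀ : ℝ) (hε : 0 < ε) (ψ : Fock (Orb (FermionTorus 2 L))) (hψ : star ψ ⬝ᵥ ψ = 1)
    (hseed : m₀ * (R₀ : ℝ) ^ 2 ≤ (∑ x : TorusSite 2 L, ∑ y : TorusSite 2 L,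
        (∏ i : Fin 2, max 0 (1 - |(((y i - x i).valMinAbs : ℤ) : ℝ)| / (R₀ : ℝ))) *
          (star (localPair dWaveFormFactor L x *ᵥ ψ) ⬝ᵥ (localPair dWaveFormFactor L y *ᵥ ψ)).re) /
        (L : ℝ) ^ 2)
    (hwin : (∑ m : Fin 2 → ZMod L, if m ≠ 0 ∧ (2 * Real.pi / (L : ℝ)) ^ 2 *
          (∑ i : Fin 2, (((m i).valMinAbs : ℤ) : ℝ) ^ 2) ≤ ε ^ 2 then
        (star (Matrix.mulVec (pairFieldAt dWaveFormFactor L m) ψ) ⬝ᵥ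
          Matrix.mulVec (pairFieldAt dWaveFormFactor L m) ψ).re / (L : ℝ) ^ 2 else 0) ≤
        C * ε * (L : ℝ) ^ 2) :
    m₀ - C * ε - 64 * Real.pi ^ 2 / ((R₀ : ℝ) ^ 2 * ε ^ 2) ≤
      (star ψ ⬝ᵥ ((pairField dWaveFormFactor L)ᴴ * pairField dWaveFormFactor L) *ᵥ ψ).re /
        (L : ℝ) ^ 4 := by
  have hRpos : (0 : ℝ) < R₀ := Nat.cast_pos.2 hR₀
  have hLpos : (0 : ℝ) < L := Nat.cast_pos.2 (Nat.pos_of_ne_zero (NeZero.ne L))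
  set Cd : ℝ := ∑ e ∈ insert (0 : Site 2) unitSteps, ‖((dWaveFormFactor e / Real.sqrt 2 : ℝ) : ℂ)‖ * 2
    with hCd
  have hglue := FunctionFieldCertificateAssembly.fejer_glue dWaveFormFactor L R₀ hR₀ hRL ε hε ψ hψ
  -- the block term is `≥ m₀`
  have hblock : m₀ ≤ (∑ x : TorusSite 2 L, ∑ y : TorusSite 2 L,
      (∏ i : Fin 2, max 0 (1 - |(((y i - x i).valMinAbs : ℤ) : ℝ)| / (R₀ : ℝ))) *
        (star (localPair dWaveFormFactor L x *ᵥ ψ) ⬝ᵥ (localPair dWaveFormFactor L y *ᵥ ψ)).re) /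
      ((R₀ : ℝ) ^ 2 * (L : ℝ) ^ 2) := by
    rw [le_div_iff₀ (by positivity)] at hseed ⊢
    nlinarith [hseed]
  -- the strict window of the Fejér closure sits inside the route's closed window, termwise `S_ψ ≥ 0`
  have hsub : (∑ m ∈ (Finset.univ.filter fun m : TorusSite 2 L => m ≠ 0 ∧ momentumNormSq L m < ε ^ 2),
      pairStructureFactor dWaveFormFactor L ψ m) ≤
      ∑ m : Fin 2 → ZMod L, if m ≠ 0 ∧ (2 * Real.pi / (L : ℝ)) ^ 2 *
          (∑ i : Fin 2, (((m i).valMinAbs : ℤ) : ℝ) ^ 2) ≤ ε ^ 2 then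
        (star (Matrix.mulVec (pairFieldAt dWaveFormFactor L m) ψ) ⬝ᵥ
          Matrix.mulVec (pairFieldAt dWaveFormFactor L m) ψ).re / (L : ℝ) ^ 2 else 0 := by
    rw [← Finset.sum_filter]
    refine Finset.sum_le_sum_of_subset_of_nonneg (fun m hm => ?_) (fun m _ _ => ?_)
    · simp only [Finset.mem_filter, Finset.mem_univ, true_and] at hm ⊢
      exact ⟨hm.1, (le_of_eq (momentumNormSq_apply m).symm).trans hm.2.le⟩
    · exact pairStructureFactor_nonneg dWaveFormFactor L ψ m
  -- the window term is `≤ C ε`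
  have hwin' : (∑ m ∈ (Finset.univ.filter fun m : TorusSite 2 L => m ≠ 0 ∧ momentumNormSq L m < ε ^ 2),
      pairStructureFactor dWaveFormFactor L ψ m) / (L : ℝ) ^ 2 ≤ C * ε := by
    rw [div_le_iff₀ (by positivity)]
    exact hsub.trans hwin
  -- the tail term is `≤ 64π²/(R₀² ε²)`
  have htail : 2 * Real.pi ^ 2 * Cd ^ 2 / ((R₀ : ℝ) ^ 2 * ε ^ 2) ≤
      64 * Real.pi ^ 2 / ((R₀ : ℝ) ^ 2 * ε ^ 2) := by
    refine div_le_div_of_nonneg_right ?_ (by positivity)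
    have h32 : Cd ^ 2 ≤ 32 := dWave_localPairNormBound_sq_le
    nlinarith [h32, sq_nonneg Real.pi]
  -- assemble (`expect A ψ = star ψ ⬝ᵥ A *ᵥ ψ` by `rfl`)
  have hE : m₀ - C * ε - 64 * Real.pi ^ 2 / ((R₀ : ℝ) ^ 2 * ε ^ 2) ≤
      (expect ((pairField dWaveFormFactor L)ᴴ * pairField dWaveFormFactor L) ψ).re / (L : ℝ) ^ 4 := by
    linarith
  exact hE

end Pointwise

/-! ### At a fixed `(U, δ)`: seed + window constants ⇒ uniform pair order ⇒ the crux -/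

/-- **Seed + window ⇒ uniform sector pair order, at a fixed `(U, δ)`.** If at `(U, δ)`
(i) SEED: for all even `L ≥ L₀` every normalised `(N_L, 0)`-sector ground state has Fejér-box `d`-wave
order `m₀ R₀² ≤ T_{R₀}(ψ)/L²` at ONE scale `0 < R₀`, and (ii) WINDOW: the Σ-form window bound of
`WindowInfraredBound` holds at `(U, δ)` with constants `(C, ε₀, L₁)` (literal body), then for every
`ε ∈ (0, ε₀]` and all even `L ≥ max (max L₀ L₁) (2R₀)` every normalised sector ground state has
`m₀ - C ε - 64π²/(R₀² ε²) ≤ Re⟨ψ, Δ_dᴴ Δ_d ψ⟩/L⁴`. Dyson–Lieb–Simon (1978) Thm 3.1 (shape of the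
argument); Kennedy–Lieb–Shastry (1988). [folklore] -/
theorem uniformPairOrder_of_seed_of_window (U δ : ℝ) (m₀ C ε₀ ε : ℝ) (R₀ L₀ L₁ : ℕ)
    (hR₀ : 0 < R₀) (hε : 0 < ε) (hεε₀ : ε ≤ ε₀)
    (hseed : ∀ (L : ℕ) [NeZero L], L₀ ≤ L → Even L →
      ∀ ψ : Fock (Orb (FermionTorus 2 L)), star ψ ⬝ᵥ ψ = 1 →
        IsGroundStateInSector (hubbardTorus 2 L 1 U) (2 * ⌊(1 - δ) * (L : ℝ) ^ 2 / 2⌋₊) 0 ψ →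
          m₀ * (R₀ : ℝ) ^ 2 ≤ (∑ x : TorusSite 2 L, ∑ y : TorusSite 2 L,
            (∏ i : Fin 2, max 0 (1 - |(((y i - x i).valMinAbs : ℤ) : ℝ)| / (R₀ : ℝ))) *
              (star (localPair dWaveFormFactor L x *ᵥ ψ) ⬝ᵥ
                (localPair dWaveFormFactor L y *ᵥ ψ)).re) / (L : ℝ) ^ 2)
    (hwin : ∀ ε' ∈ Set.Ioc (0:ℝ) ε₀, ∀ (L : ℕ) [NeZero L], L₁ ≤ L → Even L →
      let D : (Fin 2 → ZMod L) → Matrix (Finset (Orb (FermionTorus 2 L)))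
          (Finset (Orb (FermionTorus 2 L))) ℂ := fun m => ∑ x : Fin 2 → ZMod L,
            Complex.exp (-(2 * Real.pi * Complex.I * (((∑ i : Fin 2, m i * x i).val : ℕ) : ℂ) /
              (L : ℂ))) • localPair dWaveFormFactor L x
      ∀ ψ : Fock (Orb (FermionTorus 2 L)), star ψ ⬝ᵥ ψ = 1 →
        IsGroundStateInSector (hubbardTorus 2 L 1 U) (2 * ⌊(1 - δ) * (L : ℝ) ^ 2 / 2⌋₊) 0 ψ →
          (∑ m : Fin 2 → ZMod L, if m ≠ 0 ∧ (2 * Real.pi / (L : ℝ)) ^ 2 *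
              (∑ i : Fin 2, (((m i).valMinAbs : ℤ) : ℝ) ^ 2) ≤ ε' ^ 2 then
            (star (Matrix.mulVec (D m) ψ) ⬝ᵥ Matrix.mulVec (D m) ψ).re / (L : ℝ) ^ 2 else 0) ≤
            C * ε' * (L : ℝ) ^ 2) :
    ∀ (L : ℕ) [NeZero L], max (max L₀ L₁) (2 * R₀) ≤ L → Even L →
      ∀ ψ : Fock (Orb (FermionTorus 2 L)), star ψ ⬝ᵥ ψ = 1 →
        IsGroundStateInSector (hubbardTorus 2 L 1 U) (2 * ⌊(1 - δ) * (L : ℝ) ^ 2 / 2⌋₊) 0 ψ →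
          m₀ - C * ε - 64 * Real.pi ^ 2 / ((R₀ : ℝ) ^ 2 * ε ^ 2) ≤
            (star ψ ⬝ᵥ ((pairField dWaveFormFactor L)ᴴ * pairField dWaveFormFactor L) *ᵥ ψ).re /
              (L : ℝ) ^ 4 := by
  intro L _ hL hE ψ hψ hgs
  have hL₀ : L₀ ≤ L := le_trans (le_trans (le_max_left _ _) (le_max_left _ _)) hL
  have hL₁ : L₁ ≤ L := le_trans (le_trans (le_max_right _ _) (le_max_left _ _)) hL
  have h2R : 2 * R₀ ≤ L := le_trans (le_max_right _ _) hL
  have hs := hseed L hL₀ hE ψ hψ hgs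
  have hw := hwin ε ⟨hε, hεε₀⟩ L hL₁ hE ψ hψ hgs
  exact pairOrder_ge_seed_sub_window_sub_tail R₀ hR₀ h2R ε C m₀ hε ψ hψ hs hw

/-- **ONE-SCALE COLLAPSE: seed + window ⇒ `MesoscopicPairOrder`.** If at some `U > 0`,
`δ ∈ (0, 1/2)` there are window constants `(C, ε₀)` (the Σ-form window bound of `WindowInfraredBound`
at that `(U, δ)`, literal body), a window `0 < ε ≤ ε₀`, ONE scale `0 < R₀` and a seed margin `m₀` with
`C ε + 64π²/(R₀² ε²) < m₀` such that every normalised `(N_L, 0)`-sector ground state has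
`m₀ R₀² ≤ T_{R₀}(ψ)/L²` for all large even `L`, then `MesoscopicPairOrder` holds — at that `(U, δ)`,
with margin `a = m₀ - C ε - 64π²/(R₀² ε²) > 0`, at EVERY scale (uniform pair order by
`uniformPairOrder_of_seed_of_window`, then `mesoscopicPairOrder_of_uniformPairOrder`). This is the
typed `SeedAndWindowGiveCrux` of card one-scale-seed-fejer-ladder / `SingleScaleExcess` of card
k0-domination-single-scale. [folklore] -/
theorem mesoscopicPairOrder_of_seed_of_window
    (h : ∃ U : ℝ, 0 < U ∧ ∃ δ ∈ Set.Ioo (0:ℝ) (1 / 2), ∃ (C ε₀ ε m₀ : ℝ) (R₀ : ℕ),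
      0 < ε ∧ ε ≤ ε₀ ∧ 0 < R₀ ∧ C * ε + 64 * Real.pi ^ 2 / ((R₀ : ℝ) ^ 2 * ε ^ 2) < m₀ ∧
      (∃ L₀ : ℕ, ∀ (L : ℕ) [NeZero L], L₀ ≤ L → Even L →
        ∀ ψ : Fock (Orb (FermionTorus 2 L)), star ψ ⬝ᵥ ψ = 1 →
          IsGroundStateInSector (hubbardTorus 2 L 1 U) (2 * ⌊(1 - δ) * (L : ℝ) ^ 2 / 2⌋₊) 0 ψ →
            m₀ * (R₀ : ℝ) ^ 2 ≤ (∑ x : TorusSite 2 L, ∑ y : TorusSite 2 L,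
              (∏ i : Fin 2, max 0 (1 - |(((y i - x i).valMinAbs : ℤ) : ℝ)| / (R₀ : ℝ))) *
                (star (localPair dWaveFormFactor L x *ᵥ ψ) ⬝ᵥ
                  (localPair dWaveFormFactor L y *ᵥ ψ)).re) / (L : ℝ) ^ 2) ∧
      (∃ L₁ : ℕ, ∀ ε' ∈ Set.Ioc (0:ℝ) ε₀, ∀ (L : ℕ) [NeZero L], L₁ ≤ L → Even L →
        let D : (Fin 2 → ZMod L) → Matrix (Finset (Orb (FermionTorus 2 L)))
            (Finset (Orb (FermionTorus 2 L))) ℂ := fun m => ∑ x : Fin 2 → ZMod L,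
              Complex.exp (-(2 * Real.pi * Complex.I * (((∑ i : Fin 2, m i * x i).val : ℕ) : ℂ) /
                (L : ℂ))) • localPair dWaveFormFactor L x
        ∀ ψ : Fock (Orb (FermionTorus 2 L)), star ψ ⬝ᵥ ψ = 1 →
          IsGroundStateInSector (hubbardTorus 2 L 1 U) (2 * ⌊(1 - δ) * (L : ℝ) ^ 2 / 2⌋₊) 0 ψ →
            (∑ m : Fin 2 → ZMod L, if m ≠ 0 ∧ (2 * Real.pi / (L : ℝ)) ^ 2 *
                (∑ i : Fin 2, (((m i).valMinAbs : ℤ) : ℝ) ^ 2) ≤ ε' ^ 2 then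
              (star (Matrix.mulVec (D m) ψ) ⬝ᵥ Matrix.mulVec (D m) ψ).re / (L : ℝ) ^ 2 else 0) ≤
              C * ε' * (L : ℝ) ^ 2)) :
    MesoscopicPairOrder := by
  obtain ⟨U, hU, δ, hδ, C, ε₀, ε, m₀, R₀, hε, hεε₀, hR₀, hmargin, ⟨L₀, hseed⟩, ⟨L₁, hwin⟩⟩ := h
  refine mesoscopicPairOrder_of_uniformPairOrder
    ⟨U, hU, δ, hδ, m₀ - C * ε - 64 * Real.pi ^ 2 / ((R₀ : ℝ) ^ 2 * ε ^ 2), by linarith,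
      max (max L₀ L₁) (2 * R₀), ?_⟩
  intro L _ hL hE ψ hψ hgs
  exact uniformPairOrder_of_seed_of_window U δ m₀ C ε₀ ε R₀ L₀ L₁ hR₀ hε hεε₀ hseed hwin L hL hE ψ hψ hgs

/-- **Seed + the route's pole half ⇒ the crux.** If `WindowInfraredBound` (stmt-1089) holds and, at
some `U > 0`, `δ ∈ (0, 1/2)` whose window constants are `(C, ε₀)`, a seed at ONE scale `R₀` with a
margin `m₀ > C ε + 64π²/(R₀² ε²)` for some `ε ∈ (0, ε₀]` holds in every normalised sector ground state
for all large even `L`, then `MesoscopicPairOrder`. Stated with the window constants exposed: for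
every `(U, δ)` the pole half provides `(C, ε₀)`, and ANY seed beating the threshold at that `(U, δ)`
closes the crux. [folklore] -/
theorem mesoscopicPairOrder_of_seed_of_windowInfraredBound (hW : WindowInfraredBound)
    (U : ℝ) (hU : 0 < U) (δ : ℝ) (hδ : δ ∈ Set.Ioo (0:ℝ) (1 / 2)) :
    ∃ C ε₀ : ℝ, 0 ≤ C ∧ 0 < ε₀ ∧ ∀ (ε m₀ : ℝ) (R₀ : ℕ), 0 < ε → ε ≤ ε₀ → 0 < R₀ →
      C * ε + 64 * Real.pi ^ 2 / ((R₀ : ℝ) ^ 2 * ε ^ 2) < m₀ →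
      (∃ L₀ : ℕ, ∀ (L : ℕ) [NeZero L], L₀ ≤ L → Even L →
        ∀ ψ : Fock (Orb (FermionTorus 2 L)), star ψ ⬝ᵥ ψ = 1 →
          IsGroundStateInSector (hubbardTorus 2 L 1 U) (2 * ⌊(1 - δ) * (L : ℝ) ^ 2 / 2⌋₊) 0 ψ →
            m₀ * (R₀ : ℝ) ^ 2 ≤ (∑ x : TorusSite 2 L, ∑ y : TorusSite 2 L,
              (∏ i : Fin 2, max 0 (1 - |(((y i - x i).valMinAbs : ℤ) : ℝ)| / (R₀ : ℝ))) *
                (star (localPair dWaveFormFactor L x *ᵥ ψ) ⬝ᵥ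
                  (localPair dWaveFormFactor L y *ᵥ ψ)).re) / (L : ℝ) ^ 2) →
      MesoscopicPairOrder := by
  obtain ⟨C, ε₀, hC, hε₀, L₁, hwin⟩ := hW U hU δ hδ
  refine ⟨C, ε₀, hC, hε₀, fun ε m₀ R₀ hε hεε₀ hR₀ hmargin hseed => ?_⟩
  exact mesoscopicPairOrder_of_seed_of_window
    ⟨U, hU, δ, hδ, C, ε₀, ε, m₀, R₀, hε, hεε₀, hR₀, hmargin, hseed, L₁, hwin⟩

/-- **Registered form of the one-scale collapse** (sub-goal `mesoscopicPairOrderOfSeedOfWindow` of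
crux stmt-HubbardSuperconductivity-7331, line `Sketch`; verbatim
`mesoscopicPairOrder_of_seed_of_window`). [folklore] -/
theorem mesoscopicPairOrderOfSeedOfWindow : (∃ U : ℝ, 0 < U ∧ ∃ δ ∈ Set.Ioo (0:ℝ) (1 / 2), ∃ (C ε₀ ε m₀ : ℝ) (R₀ : ℕ), 0 < ε ∧ ε ≤ ε₀ ∧ 0 < R₀ ∧ C * ε + 64 * Real.pi ^ 2 / ((R₀ : ℝ) ^ 2 * ε ^ 2) < m₀ ∧ (∃ L₀ : ℕ, ∀ (L : ℕ) [NeZero L], L₀ ≤ L → Even L → ∀ ψ : Fock (Orb (FermionTorus 2 L)), star ψ ⬝ᵥ ψ = 1 → IsGroundStateInSector (hubbardTorus 2 L 1 U) (2 * ⌊(1 - δ) * (L : ℝ) ^ 2 / 2⌋₊) 0 ψ → m₀ * (R₀ : ℝ) ^ 2 ≤ (∑ x : TorusSite 2 L, ∑ y : TorusSite 2 L, (∏ i : Fin 2, max 0 (1 - |(((y i - x i).valMinAbs : ℤ) : ℝ)| / (R₀ : ℝ))) * (star (localPair dWaveFormFactor L x *ᵥ ψ) ⬝ᵥ (localPair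 dWaveFormFactor L y *ᵥ ψ)).re) / (L : ℝ) ^ 2) ∧ (∃ L₁ : ℕ, ∀ ε' ∈ Set.Ioc (0:ℝ) ε₀, ∀ (L : ℕ) [NeZero L], L₁ ≤ L → Even L → let D : (Fin 2 → ZMod L) → Matrix (Finset (Orb (FermionTorus 2 L))) (Finset (Orb (FermionTorus 2 L))) ℂ := fun m => ∑ x : Fin 2 → ZMod L, Complex.exp (-(2 * Real.pi * Complex.I * (((∑ i : Fin 2, m i * x i).val : ℕ) : ℂ) / (L : ℂ))) • localPair dWaveFormFactor L x; ∀ ψ : Fock (Orb (FermionTorus 2 L)), star ψ ⬝ᵥ ψ = 1 → IsGroundStateInSector (hubbardTorus 2 L 1 U) (2 * ⌊(1 - δ) * (L : ℝ) ^ 2 / 2⌋₊) 0 ψ → (∑ m : Fin 2 → ZMod L, if m ≠ 0 ∧ (2 * Real.pi / (L : ℝ)) ^ 2 * (∑ i : Fin 2, (((m i).valMinAbs : ℤ) : ℝ) ^ 2) ≤ ε' ^ 2 then (star (Matrix.mulVec (D m) ψ) ⬝ᵥ Matrix.mulVec (D m) ψ).re / (L : ℝ) ^ 2 else 0) ≤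 C * ε' * (L : ℝ) ^ 2)) → Summit.HubbardSuperconductivity.HubbardSuperconductivity.Theses.FunctionFieldCertificate.MesoscopicPairOrder :=
  mesoscopicPairOrder_of_seed_of_window

end Summit.HubbardSuperconductivity.HubbardSuperconductivity.Theorems.FunctionFieldCertificate
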